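import Summits.QuantumAdvantage.QuantumAdvantage.Theorems.SymplecticPurityGaussianDegreeBoundWords
import Summits.QuantumAdvantage.QuantumAdvantage.Theorems.SymplecticPuritySymplecticPurityBoundPauli

/-!
# `SymplecticPurity.CompositeFrameBound` (stmt-QuantumAdvantage-10730) — magic budget I: superpositions of Pauli images

Helper file (prover, line `Sketch`, `--supports stmt-QuantumAdvantage-10730`).  The Pauli-algebra /
Cauchy–Schwarz core of a rigorous quantitative SUB-CASE of the crux ("magic budget of the middle
layer", assembled in `SymplecticPurityCompositeFrameBoundMagicBudgetFrame.lean`): a depth-3 frame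
`U₂ U U₁` whose middle layer `U` is close to the Clifford group in Pauli 1-norm cannot compress the
cube state, whatever `U` is (Gaussian or not).  For a vector `φ` with `|⟨φ|φ⟩| ≤ 1` that is
`ε`-flat (all non-identity `|⟨φ|σ_S|φ⟩| ≤ ε`):

* `mb_norm_exp_superposition_le` — a superposition `ψ = Σ_t b_t σ_{P_t} φ` of PAULI IMAGES of `φ`
  has `|⟨ψ|σ_S|ψ⟩| ≤ Σ_{t,t'} |b_t||b_{t'}| · |⟨φ|σ_{P_t · S · P_{t'}}|φ⟩|` (strings form a group
  up to unit phases, `pauliString_mul`);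
* `mb_sum_norm_exp_sq_superposition_le` — hence for every family `𝒯` of strings,
  `Σ_{S ∈ 𝒯} |⟨ψ|σ_S|ψ⟩|² ≤ (Σ_t |b_t|)⁴ · (1 + |𝒯| ε²)`: weighted Cauchy–Schwarz over the pairs
  `(t,t')`, and for each pair the relabelling `S ↦ P_t · S · P_{t'}` is injective and hits the
  identity at most once (`mb_sum_sq_relabel_le`);
* `mb_pauli_expansion` — completeness of the Pauli strings, `M = 2^{-|ι|} Σ_S Tr(σ_S M) σ_S`, used
  to write any middle layer as a combination of Pauli strings.
-/

set_option linter.dupNamespace false -- D-0017: single-problem summit ⇒ `QuantumAdvantage.QuantumAdvantage` by design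

noncomputable section

namespace Summit.QuantumAdvantage.QuantumAdvantage.Theorems.SymplecticPurity.CompositeFrameBound

open Literature.Computability.Cryptography Literature.Computability.QuantumComplexity Matrix Finset
open Summit.QuantumAdvantage.QuantumAdvantage.Theorems.SymplecticPurity

section Generic

variable {ι : Type*} [Fintype ι] [DecidableEq ι]

/-! ## Pauli-group bookkeeping -/

/-- Left multiplication in the Pauli letter group (mod phases) is injective. -/
theorem mb_letterMul_right_injective (P : Pauli) : Function.Injective fun Q : Pauli => P.letterMul Q := by
  intro a b h
  cases P <;> cases a <;> cases b <;> first | rfl | cases h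

/-- Right multiplication in the Pauli letter group (mod phases) is injective. -/
theorem mb_letterMul_left_injective (P : Pauli) : Function.Injective fun Q : Pauli => Q.letterMul P := by
  intro a b h
  cases P <;> cases a <;> cases b <;> first | rfl | cases h

omit [Fintype ι] [DecidableEq ι] in
/-- The two-sided relabelling `S ↦ P · S · P'` of strings (mod phases) is injective. -/
theorem mb_relabel_injective (P P' : ι → Pauli) :
    Function.Injective fun S : ι → Pauli => stringMul (stringMul P S) P' := by
  intro S T h
  funext i
  have hi := congrFun h i
  simp only [stringMul] at hi
  exact mb_letterMul_right_injective (P i) (mb_letterMul_left_injective (P' i) hi)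

/-- **Transition expectations are expectations.** For Pauli strings `P, P', S` and any vector `φ`:
`⟨σ_P φ| σ_S |σ_{P'} φ⟩ = (unit phase) · ⟨φ| σ_{P·S·P'} |φ⟩`. -/
theorem mb_transition_eq (φ : (ι → Bool) → ℂ) (P P' S : ι → Pauli) :
    star (pauliString P *ᵥ φ) ⬝ᵥ (pauliString S *ᵥ (pauliString P' *ᵥ φ)) =
      (stringPhase P S * stringPhase (stringMul P S) P') •
        (star φ ⬝ᵥ (pauliString (stringMul (stringMul P S) P') *ᵥ φ)) := by
  rw [Matrix.star_mulVec, conjTranspose_pauliString, ← Matrix.dotProduct_mulVec,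
    Matrix.mulVec_mulVec, Matrix.mulVec_mulVec, pauliString_mul, Matrix.smul_mul, pauliString_mul,
    smul_smul, Matrix.smul_mulVec, dotProduct_smul]

/-- Norm form of `mb_transition_eq`: `|⟨σ_P φ| σ_S |σ_{P'} φ⟩| = |⟨φ| σ_{P·S·P'} |φ⟩|`. -/
theorem mb_norm_transition_eq (φ : (ι → Bool) → ℂ) (P P' S : ι → Pauli) :
    ‖star (pauliString P *ᵥ φ) ⬝ᵥ (pauliString S *ᵥ (pauliString P' *ᵥ φ))‖ =
      ‖star φ ⬝ᵥ (pauliString (stringMul (stringMul P S) P') *ᵥ φ)‖ := by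
  rw [mb_transition_eq, norm_smul, norm_mul, norm_stringPhase, norm_stringPhase, one_mul, one_mul]

/-! ## Superpositions of Pauli images -/

variable {κ : Type*} [Fintype κ]

/-- The expectation of `σ_S` in a superposition `ψ = Σ_t b_t σ_{P_t} φ`, expanded over pairs. -/
theorem mb_exp_superposition_eq (φ : (ι → Bool) → ℂ) (b : κ → ℂ) (P : κ → ι → Pauli)
    (S : ι → Pauli) :
    star (∑ t, b t • (pauliString (P t) *ᵥ φ)) ⬝ᵥ
        (pauliString S *ᵥ ∑ t, b t • (pauliString (P t) *ᵥ φ)) =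
      ∑ t, ∑ t', star (b t) * b t' *
        (star (pauliString (P t) *ᵥ φ) ⬝ᵥ (pauliString S *ᵥ (pauliString (P t') *ᵥ φ))) := by
  rw [star_sum, Matrix.mulVec_sum, sum_dotProduct]
  refine Finset.sum_congr rfl fun t _ => ?_
  rw [dotProduct_sum]
  refine Finset.sum_congr rfl fun t' _ => ?_
  rw [star_smul, Matrix.mulVec_smul, smul_dotProduct, dotProduct_smul, smul_smul, smul_eq_mul,
    Complex.star_def]

/-- **Triangle inequality for a superposition of Pauli images**:
`|⟨ψ|σ_S|ψ⟩| ≤ Σ_{t,t'} |b_t| |b_{t'}| · |⟨φ| σ_{P_t·S·P_{t'}} |φ⟩|`. -/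
theorem mb_norm_exp_superposition_le (φ : (ι → Bool) → ℂ) (b : κ → ℂ) (P : κ → ι → Pauli)
    (S : ι → Pauli) :
    ‖star (∑ t, b t • (pauliString (P t) *ᵥ φ)) ⬝ᵥ
        (pauliString S *ᵥ ∑ t, b t • (pauliString (P t) *ᵥ φ))‖ ≤
      ∑ t, ∑ t', ‖b t‖ * ‖b t'‖ *
        ‖star φ ⬝ᵥ (pauliString (stringMul (stringMul (P t) S) (P t')) *ᵥ φ)‖ := by
  rw [mb_exp_superposition_eq]
  refine (norm_sum_le _ _).trans (Finset.sum_le_sum fun t _ => ?_)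
  refine (norm_sum_le _ _).trans (Finset.sum_le_sum fun t' _ => ?_)
  rw [norm_mul, norm_mul, norm_star, mb_norm_transition_eq]

/-- Weighted Cauchy–Schwarz: `(Σ_j w_j x_j)² ≤ (Σ_j w_j) · (Σ_j w_j x_j²)` for non-negative weights. -/
theorem mb_sq_sum_le {α : Type*} (s : Finset α) (w x : α → ℝ) (hw : ∀ j ∈ s, 0 ≤ w j) :
    (∑ j ∈ s, w j * x j) ^ 2 ≤ (∑ j ∈ s, w j) * ∑ j ∈ s, w j * x j ^ 2 := by
  have h := Finset.sum_mul_sq_le_sq_mul_sq s (fun j => Real.sqrt (w j)) (fun j => Real.sqrt (w j) * x j)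
  have h1 : ∀ j ∈ s, Real.sqrt (w j) * (Real.sqrt (w j) * x j) = w j * x j := by
    intro j hj
    rw [← mul_assoc, Real.mul_self_sqrt (hw j hj)]
  have h2 : ∀ j ∈ s, Real.sqrt (w j) ^ 2 = w j := fun j hj => Real.sq_sqrt (hw j hj)
  have h3 : ∀ j ∈ s, (Real.sqrt (w j) * x j) ^ 2 = w j * x j ^ 2 := by
    intro j hj
    rw [mul_pow, Real.sq_sqrt (hw j hj)]
  rw [Finset.sum_congr rfl h1, Finset.sum_congr rfl h2, Finset.sum_congr rfl h3] at h
  exact h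

/-- **Mass of a relabelled family on a flat vector.** If `φ` has `|⟨φ|φ⟩| ≤ 1` and
`|⟨φ|σ_Q|φ⟩| ≤ ε` for every `Q ≠ I`, then for every family `𝒯` and strings `P, P'`:
`Σ_{S ∈ 𝒯} |⟨φ| σ_{P·S·P'} |φ⟩|² ≤ 1 + |𝒯| ε²` (the relabelling is injective, so at most one `S`
lands on the identity). -/
theorem mb_sum_sq_relabel_le (φ : (ι → Bool) → ℂ) {ε : ℝ}
    (hunit : ‖star φ ⬝ᵥ φ‖ ≤ 1)
    (hflat : ∀ Q : ι → Pauli, Q ≠ (fun _ => Pauli.I) → ‖star φ ⬝ᵥ (pauliString Q *ᵥ φ)‖ ≤ ε)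
    (𝒯 : Finset (ι → Pauli)) (P P' : ι → Pauli) :
    ∑ S ∈ 𝒯, ‖star φ ⬝ᵥ (pauliString (stringMul (stringMul P S) P') *ᵥ φ)‖ ^ 2 ≤
      1 + 𝒯.card * ε ^ 2 := by
  classical
  set g : (ι → Pauli) → (ι → Pauli) := fun S => stringMul (stringMul P S) P' with hg
  -- split 𝒯 into the (at most one) preimage of the identity and the rest
  have hε : ∀ S ∈ 𝒯.filter (fun S => g S ≠ fun _ => Pauli.I),
      ‖star φ ⬝ᵥ (pauliString (g S) *ᵥ φ)‖ ^ 2 ≤ ε ^ 2 := by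
    intro S hS
    rw [Finset.mem_filter] at hS
    have h0 : 0 ≤ ‖star φ ⬝ᵥ (pauliString (g S) *ᵥ φ)‖ := norm_nonneg _
    exact pow_le_pow_left₀ h0 (hflat _ hS.2) 2
  have hI : ∑ S ∈ 𝒯.filter (fun S => g S = fun _ => Pauli.I),
      ‖star φ ⬝ᵥ (pauliString (g S) *ᵥ φ)‖ ^ 2 ≤ 1 := by
    have hcard : (𝒯.filter (fun S => g S = fun _ => Pauli.I)).card ≤ 1 := by
      rw [Finset.card_le_one]
      intro a ha b hb
      rw [Finset.mem_filter] at ha hb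
      exact mb_relabel_injective P P' (ha.2.trans hb.2.symm)
    have each : ∀ S ∈ 𝒯.filter (fun S => g S = fun _ => Pauli.I),
        ‖star φ ⬝ᵥ (pauliString (g S) *ᵥ φ)‖ ^ 2 ≤ 1 := by
      intro S hS
      rw [Finset.mem_filter] at hS
      rw [hS.2, pauliString_const_I, Matrix.one_mulVec]
      have h0 : 0 ≤ ‖star φ ⬝ᵥ φ‖ := norm_nonneg _
      nlinarith [hunit]
    calc ∑ S ∈ 𝒯.filter (fun S => g S = fun _ => Pauli.I), ‖star φ ⬝ᵥ (pauliString (g S) *ᵥ φ)‖ ^ 2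
        ≤ ∑ S ∈ 𝒯.filter (fun S => g S = fun _ => Pauli.I), (1 : ℝ) := Finset.sum_le_sum each
      _ = (𝒯.filter (fun S => g S = fun _ => Pauli.I)).card := by simp
      _ ≤ 1 := by exact_mod_cast hcard
  have split := (Finset.sum_filter_add_sum_filter_not 𝒯 (fun S => g S = fun _ => Pauli.I)
    (fun S => ‖star φ ⬝ᵥ (pauliString (g S) *ᵥ φ)‖ ^ 2)).symm
  rw [split]
  have hrest : ∑ S ∈ 𝒯.filter (fun S => ¬ g S = fun _ => Pauli.I),
      ‖star φ ⬝ᵥ (pauliString (g S) *ᵥ φ)‖ ^ 2 ≤ 𝒯.card * ε ^ 2 := by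
    calc ∑ S ∈ 𝒯.filter (fun S => ¬ g S = fun _ => Pauli.I), ‖star φ ⬝ᵥ (pauliString (g S) *ᵥ φ)‖ ^ 2
        ≤ ∑ S ∈ 𝒯.filter (fun S => ¬ g S = fun _ => Pauli.I), ε ^ 2 := Finset.sum_le_sum hε
      _ = (𝒯.filter (fun S => ¬ g S = fun _ => Pauli.I)).card * ε ^ 2 := by
          rw [Finset.sum_const, nsmul_eq_mul]
      _ ≤ 𝒯.card * ε ^ 2 := by
          apply mul_le_mul_of_nonneg_right _ (sq_nonneg ε)
          exact_mod_cast Finset.card_filter_le _ _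
  linarith

/-- **Family mass of a superposition of Pauli images of a flat vector** (the magic budget
inequality).  If `|⟨φ|φ⟩| ≤ 1` and `|⟨φ|σ_Q|φ⟩| ≤ ε` for all `Q ≠ I`, then for every
`ψ = Σ_t b_t σ_{P_t} φ` and every family `𝒯` of Pauli strings,
`Σ_{S ∈ 𝒯} |⟨ψ|σ_S|ψ⟩|² ≤ (Σ_t |b_t|)⁴ · (1 + |𝒯| ε²)`. -/
theorem mb_sum_norm_exp_sq_superposition_le (φ : (ι → Bool) → ℂ) {ε : ℝ}
    (hunit : ‖star φ ⬝ᵥ φ‖ ≤ 1)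
    (hflat : ∀ Q : ι → Pauli, Q ≠ (fun _ => Pauli.I) → ‖star φ ⬝ᵥ (pauliString Q *ᵥ φ)‖ ≤ ε)
    (b : κ → ℂ) (P : κ → ι → Pauli) (𝒯 : Finset (ι → Pauli)) :
    ∑ S ∈ 𝒯, ‖star (∑ t, b t • (pauliString (P t) *ᵥ φ)) ⬝ᵥ
        (pauliString S *ᵥ ∑ t, b t • (pauliString (P t) *ᵥ φ))‖ ^ 2 ≤
      (∑ t, ‖b t‖) ^ 4 * (1 + 𝒯.card * ε ^ 2) := by
  classical
  -- abbreviations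
  set f : κ × κ → (ι → Pauli) → ℝ := fun p S =>
    ‖star φ ⬝ᵥ (pauliString (stringMul (stringMul (P p.1) S) (P p.2)) *ᵥ φ)‖ with hf
  set w : κ × κ → ℝ := fun p => ‖b p.1‖ * ‖b p.2‖ with hw
  have hw0 : ∀ p ∈ (Finset.univ : Finset (κ × κ)), 0 ≤ w p :=
    fun p _ => mul_nonneg (norm_nonneg _) (norm_nonneg _)
  have hB : ∑ p : κ × κ, w p = (∑ t, ‖b t‖) ^ 2 := by
    rw [hw, Fintype.sum_prod_type, sq, Finset.sum_mul_sum]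
  -- pointwise: |⟨ψ|S|ψ⟩| ≤ Σ_p w_p f_p(S)
  have hpt : ∀ S, ‖star (∑ t, b t • (pauliString (P t) *ᵥ φ)) ⬝ᵥ
      (pauliString S *ᵥ ∑ t, b t • (pauliString (P t) *ᵥ φ))‖ ≤ ∑ p : κ × κ, w p * f p S := by
    intro S
    refine (mb_norm_exp_superposition_le φ b P S).trans (le_of_eq ?_)
    rw [Fintype.sum_prod_type]
  -- square and apply weighted Cauchy–Schwarz
  have hsq : ∀ S, ‖star (∑ t, b t • (pauliString (P t) *ᵥ φ)) ⬝ᵥ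
      (pauliString S *ᵥ ∑ t, b t • (pauliString (P t) *ᵥ φ))‖ ^ 2 ≤
        (∑ p : κ × κ, w p) * ∑ p : κ × κ, w p * f p S ^ 2 := by
    intro S
    have h0 : 0 ≤ ‖star (∑ t, b t • (pauliString (P t) *ᵥ φ)) ⬝ᵥ
      (pauliString S *ᵥ ∑ t, b t • (pauliString (P t) *ᵥ φ))‖ := norm_nonneg _
    exact (pow_le_pow_left₀ h0 (hpt S) 2).trans (mb_sq_sum_le _ w (fun p => f p S) hw0)
  calc ∑ S ∈ 𝒯, ‖star (∑ t, b t • (pauliString (P t) *ᵥ φ)) ⬝ᵥ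
          (pauliString S *ᵥ ∑ t, b t • (pauliString (P t) *ᵥ φ))‖ ^ 2
      ≤ ∑ S ∈ 𝒯, (∑ p : κ × κ, w p) * ∑ p : κ × κ, w p * f p S ^ 2 := Finset.sum_le_sum fun S _ => hsq S
    _ = (∑ p : κ × κ, w p) * ∑ p : κ × κ, w p * ∑ S ∈ 𝒯, f p S ^ 2 := by
        rw [← Finset.mul_sum, Finset.sum_comm]
        congr 1
        refine Finset.sum_congr rfl fun p _ => ?_
        rw [Finset.mul_sum]
    _ ≤ (∑ p : κ × κ, w p) * ∑ p : κ × κ, w p * (1 + 𝒯.card * ε ^ 2) := by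
        apply mul_le_mul_of_nonneg_left _ (Finset.sum_nonneg hw0)
        refine Finset.sum_le_sum fun p hp => mul_le_mul_of_nonneg_left ?_ (hw0 p hp)
        exact mb_sum_sq_relabel_le φ hunit hflat 𝒯 (P p.1) (P p.2)
    _ = (∑ t, ‖b t‖) ^ 4 * (1 + 𝒯.card * ε ^ 2) := by
        rw [← Finset.sum_mul, hB]
        ring

/-! ## The Pauli expansion of a matrix -/

/-- **Completeness of the Pauli strings**: `M = 2^{-|ι|} Σ_S Tr(σ_S M) σ_S`. -/
theorem mb_pauli_expansion (M : Matrix (ι → Bool) (ι → Bool) ℂ) :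
    M = ((2 : ℂ) ^ Fintype.card ι)⁻¹ • ∑ S : ι → Pauli, pauliCoeff M S • pauliString S := by
  ext a b
  have key : ∑ S : ι → Pauli, pauliCoeff M S * pauliString S a b = (2 : ℂ) ^ Fintype.card ι * M a b := by
    have hc : ∀ S : ι → Pauli, pauliCoeff M S = ∑ x, ∑ y, pauliString S x y * M y x := by
      intro S
      rw [pauliCoeff_eq, Matrix.trace]
      simp only [Matrix.diag_apply, Matrix.mul_apply]
    have h1 : ∀ S : ι → Pauli, pauliCoeff M S * pauliString S a b =
        ∑ x, ∑ y, M y x * (pauliString S x y * pauliString S a b) := by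
      intro S
      rw [hc, Finset.sum_mul]
      refine Finset.sum_congr rfl fun x _ => ?_
      rw [Finset.sum_mul]
      refine Finset.sum_congr rfl fun y _ => ?_
      ring
    simp only [h1]
    calc ∑ S : ι → Pauli, ∑ x, ∑ y, M y x * (pauliString S x y * pauliString S a b)
        = ∑ x, ∑ y, ∑ S : ι → Pauli, M y x * (pauliString S x y * pauliString S a b) := by
          rw [Finset.sum_comm]
          exact Finset.sum_congr rfl fun x _ => Finset.sum_comm
      _ = ∑ x, ∑ y, M y x * ∑ S : ι → Pauli, pauliString S x y * pauliString S a b := by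
          simp only [Finset.mul_sum]
      _ = ∑ x, ∑ y, (if x = b then (if y = a then M y x * (2 : ℂ) ^ Fintype.card ι else 0) else 0) := by
          refine Finset.sum_congr rfl fun x _ => Finset.sum_congr rfl fun y _ => ?_
          rw [sum_pauliString_apply_mul_apply x y b a]
          by_cases hx : x = b
          · by_cases hy : y = a
            · simp [hx, hy]
            · simp [hx, hy]
          · simp [hx]
      _ = (2 : ℂ) ^ Fintype.card ι * M a b := by
          rw [Finset.sum_eq_single b]
          · simp only [if_true]
            rw [Finset.sum_eq_single a]
            · rw [if_pos rfl]; ring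
            · intro y _ hy; rw [if_neg hy]
            · intro h; exact absurd (Finset.mem_univ a) h
          · intro x _ hx
            simp only [if_neg hx, Finset.sum_const_zero]
          · intro h; exact absurd (Finset.mem_univ b) h
  rw [Matrix.smul_apply, Matrix.sum_apply]
  simp only [Matrix.smul_apply, smul_eq_mul]
  rw [key, ← mul_assoc, inv_mul_cancel₀ (pow_ne_zero _ two_ne_zero), one_mul]

end Generic

/-- **Registered sub-goal `mb_superposition_family_bound`** (crux stmt-QuantumAdvantage-10730, line
`Sketch`): the superposition inequality `mb_sum_norm_exp_sq_superposition_le` on an `N`-qubit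
register with a `Fin m`-indexed superposition — for a vector `φ` with `|⟨φ|φ⟩| ≤ 1` that is
`ε`-flat off the identity, every `ψ = Σ_t b_t σ_{P_t} φ` and every family `𝒯` of strings satisfy
`Σ_{S∈𝒯} |⟨ψ|σ_S|ψ⟩|² ≤ (Σ_t |b_t|)⁴ (1 + |𝒯| ε²)`. -/
theorem mb_superposition_family_bound :
    ∀ (N m : ℕ) (φ : QReg N → ℂ) (ε : ℝ), ‖star φ ⬝ᵥ φ‖ ≤ 1 →
      (∀ Q : Fin N → Pauli, Q ≠ (fun _ => Pauli.I) → ‖star φ ⬝ᵥ (pauliString Q *ᵥ φ)‖ ≤ ε) →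
      ∀ (b : Fin m → ℂ) (P : Fin m → Fin N → Pauli) (𝒯 : Finset (Fin N → Pauli)),
      ∑ S ∈ 𝒯, ‖star (∑ t, b t • (pauliString (P t) *ᵥ φ)) ⬝ᵥ
          (pauliString S *ᵥ ∑ t, b t • (pauliString (P t) *ᵥ φ))‖ ^ 2 ≤
        (∑ t, ‖b t‖) ^ 4 * (1 + 𝒯.card * ε ^ 2) :=
  fun _ _ φ _ hunit hflat b P 𝒯 => mb_sum_norm_exp_sq_superposition_le φ hunit hflat b P 𝒯

end Summit.QuantumAdvantage.QuantumAdvantage.Theorems.SymplecticPurity.CompositeFrameBound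

end
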